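import Summits.QuantumFields.YangMills.Theses.BalabanUVNodes
import Summits.QuantumFields.YangMills.Theorems.BalabanUVNodesN27AtRecord12
import Summits.QuantumFields.YangMills.Theorems.BalabanUVNodesN27AtRecord12Home
import Summits.QuantumFields.YangMills.Theorems.BalabanUVNodesN27KeyedKnitWorldFree
import Summits.QuantumFields.YangMills.Theorems.BalabanUVNodesN27AtRecord12HomeOn
import Summits.QuantumFields.YangMills.Theorems.BalabanUVNodesN27AtReadingOfRecord12

/-!
# BalabanUVNodes ∕ N27 = binder B5 AT THE RECORD, XXVI — THE ROUTE-FACING FACES OF THE RE-PINNED ITEM K3′ `Theses.BalabanUVNodes.SpineGivenEndpointR12`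
# (route `route-QuantumFields-BalabanUVNodes` rev 13∕15: K3's text re-keyed to NODE 00's repaired Stage-12 record and THREADED THROUGH PRINT'S PARTITION OF UNITY —
# director LINE №99 (2) form (i) + LINE №108∕№109 (rev 15): «∀ θ h, (θ.ZtUnity F 2 ∧ θ.SlotsNondegenerate) → θ.Admissible F 2 → (B) → END → HybridNE7Under (datumOfRecord₁₂ F 2 θ h)
# END» (item stmt-QuantumFields-19792, text of record rev 15); the rev-1 item `SpineGivenEndpointR11`
# retired to `aside` — it holds ex falso at Stage 11 as pinned, module XXIII): the item follows from `Spine ₁₂C` (XXV §4), hence from `Spine ₅C` ∕ any record predicate coarser than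
# ₅C ∕ the two cluster statements at ₁₂C ∕ the rev-1 stub shape at parametric carrier records (XIV); and — the BC3 composer — from the children's estimates KEYED at the Stage-12
# tuples and asked ONLY on the guarded class «unity ∧ non-degenerate slots» (XXIVb `forall_guarded_of_keyedFaces` at the Stage-12 key); every theorem ONE application BY NAME with the item's name in the conclusion
# (cell `pub-ymgap`, HUMAN RULING D-0062 Track A, R134 seat `pub-ymgap-dag-n27-c` (s2) gen 2; `--supports` the K3′ item; COUNT-NEUTRAL; route-facing: imports the route file)

HONEST FRAMING.  COMPOSITE-node bookkeeping: every K4–K5 stub ∕ reading ∕ edge ∕ `Spine ₅C` premise is a HYPOTHESIS with NO producer at any record today (0∕1); `cr`, `rr`, `SRec`, `RRec`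
PARAMETERS (no Stage-12 carrier home in the tree yet); the item K3′ is NOT proved here and NOT claimed; inhabitation of the guarded class at `N = 2` is K0′ `Record12Inhabited` (stmt-QuantumFields-19789, open); (B) and END are the
item's antecedents, used by modus ponens inside B5 only; at Stage 12 the Stage-11 vacuity mechanism is ABSENT (XXV `not_levelZeroNegative_datumOfRecord₁₂`); nothing of Bałaban's is
instantiated or asserted; NE7 ∕ NE7b ∕ NE7c NOT PRINTED for d = 4 and NOT PROVED; NO node discharged; counts UNMOVED (typed 28∕28 · discharged 5∕27, A 5∕28); one finite four-torus
programme at fixed `ε` — NOT ℝ⁴, NOT infinite volume, NOT OS, NOT a mass gap, NOT Clay.  0 `def`, 0 `sorry`.  No decl below carries a cite tag.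
-/

namespace Summit.QuantumFields.YangMills.Theorems.BalabanUVNodesN27SpineRecord

open Literature.MathematicalPhysics.QuantumFieldTheory.Balaban1983to89
open Literature.MathematicalPhysics.QuantumFieldTheory.Balaban1983to89.T4Continuum
open T4WeightBudget (RelWeightBound)
open T4IndicatorShell (ShellWeightBound)
open T4ContinuumYM4Torus (ForSmallCouplings)
open Summit.QuantumFields.BalabanUV.T4Continuum.Spine
open Summit.QuantumFields.YangMills.Theses.BalabanUVNodes (SpineGivenEndpointR12)
open YMDAG.UVSplit
open Node00 (Stage12Params datumOfRecord₁₂ IsRecordOfRecord₁₂C)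

/-! ## §1 The item ⟺ its unity-keyed B5 sentence; the item from `Spine ₁₂C`, from `Spine ₅C`, from any coarser record predicate -/

section ItemFaces

/-- **THE ITEM IS «B5 AT EVERY UNITY-, SLOT-NONDEGENERATE-, ADMISSIBLE STAGE-12 DATUM OF RECORD OF `SU(2)` DATA»**: its two displayed antecedents (B), END are
B5-under-END's own
(`FiniteEpsData.UnderHypotheses`, definitional) — →: apply at them twice; ←: weaken. [bookkeeping] -/
theorem spineGivenEndpointR12_iff_keyedGuarded :
    SpineGivenEndpointR12 ↔ ∀ (F : T4Family) (θ : Stage12Params F 2) (hP : θ.Provisos₁₂ F 2), (θ.ZtUnity F 2 ∧ θ.SlotsNondegenerate) → θ.Admissible F 2 →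
      T4ApexHybrid.HybridNE7Under (datumOfRecord₁₂ F 2 θ hP) (DagBinding.EndpointExistence (datumOfRecord₁₂ F 2 θ hP).C.toB12) := by
  refine ⟨fun h F θ hP hG hθ => ?_, fun h F θ hP hG hθ _ _ => h F θ hP hG hθ⟩
  show (datumOfRecord₁₂ F 2 θ hP).UnderHypotheses _ fun g₀ => T4ApexHybrid.StringwiseHybridNE7 ((datumOfRecord₁₂ F 2 θ hP).scheme g₀)
  intro hB hEnd
  exact h F θ hP hG hθ hB hEnd hB hEnd

/-- **`Spine ₁₂C` AT `N = 2` GIVES THE ITEM** (XXV `k3ShapeUnity_of_spine_rec12C`: the two guards are not used — B5 at EVERY ₁₂C record is stronger). [bookkeeping] -/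
theorem spineGivenEndpointR12_of_spine_rec12C (h : Spine (N := 2) fun F D w => IsRecordOfRecord₁₂C F 2 D w) : SpineGivenEndpointR12 :=
  fun F θ hP hG hθ hB hE => k3ShapeUnity_of_spine_rec12C h F θ hP hG.1 hθ hB hE

/-- **THE ITEM FROM `Spine` AT THE STAGE-5 RECORD PREDICATE** (`N = 2`; XXV `spine_rec12C_of_spine_rec5C`, shadow road).  The premise has NO producer today. [bookkeeping] -/
theorem spineGivenEndpointR12_of_spine_rec5C (h₅ : Spine (N := 2) fun F D w => Node00.IsRecordOfRecord₅C F 2 D w) : SpineGivenEndpointR12 :=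
  spineGivenEndpointR12_of_spine_rec12C (spine_rec12C_of_spine_rec5C h₅)

/-- The item from B5 at ANY record predicate coarser than ₅C (`N = 2`; XXV `spine_rec12C_of_coarser`, tower road). [bookkeeping] -/
theorem spineGivenEndpointR12_of_coarser {Rec : RecordPred 2}
    (hle : ∀ (F : T4Family) (D : Datum F 2) (w : DagBinding.WorldP), Node00.IsRecordOfRecord₅C F 2 D w → Rec F D w) (h : Spine Rec) :
    SpineGivenEndpointR12 :=
  spineGivenEndpointR12_of_spine_rec12C (spine_rec12C_of_coarser hle h)

end ItemFaces

/-! ## §2 The knits: from the cluster statements, from the rev-1 stub shape at parametric carrier records, from the unity-guarded keyed faces (the BC3 composer) -/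

section Knits

variable (Inputs : InputsPred 2) (SRec : SpineRecordPred 2) (RRec : RateRecordPred 2)

/-- **THE ITEM FROM THE TWO CLUSTER STATEMENTS AT THE STAGE-12 RECORD** (`N = 2`): K4's hook `SpineRates ₁₂C Inputs` and K5 `SpineMatching ₁₂C Inputs` (the route module's glue
`YMDAG.UVSplit.B5_at_record` BY NAME). [bookkeeping] -/
theorem spineGivenEndpointR12_of_spineRates_spineMatching (h4 : SpineRates (fun F D w => IsRecordOfRecord₁₂C F 2 D w) Inputs)
    (h5 : SpineMatching (fun F D w => IsRecordOfRecord₁₂C F 2 D w) Inputs) : SpineGivenEndpointR12 :=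
  spineGivenEndpointR12_of_spine_rec12C (B5_at_record _ Inputs h4 h5)

/-- **THE ITEM FROM THE SEVEN K4 STUBS AND THE REV-1 K5 AT PARAMETRIC CARRIER RECORDS** (`N = 2`; XIV `spine_of_rateStubs_coreEdge` at ₁₂C): R00x · N14–N18 · N22 at `RRec` · N27x · N20 ·
N21 at `SRec` · the N19′ ∃δ-edge. [bookkeeping] -/
theorem spineGivenEndpointR12_of_rateStubs_coreEdge
    (hx : S_R00x (fun F D w => IsRecordOfRecord₁₂C F 2 D w) RRec) (h14 : S_N14 RRec) (h15 : S_N15 RRec) (h16 : S_N16 RRec)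
    (h17 : S_N17 RRec) (h18 : S_N18 RRec) (h22 : S_N22 RRec) (hx' : S_N27x (fun F D w => IsRecordOfRecord₁₂C F 2 D w) SRec)
    (h20 : S_N20 SRec) (h21 : S_N21 SRec)
    (h19 : ∀ (F : T4Family) (D : Datum F 2) (g₀ : ℕ → ℝ) (os : List (ULoop F)) (S : SpineCarriers) (R : RateCarriers 2),
      SRec F D g₀ os S → RRec F D g₀ os R → RatesAt D R → letI := S.dec
        ∃ δ : ℕ → ℝ, NE7.Core S.l₀ S.vol S.T S.Bad (fun K t τ => S.A K t τ - S.shA K t τ) (fun K t τ => S.B K t τ - S.shB K t τ) δ ∧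
          Summable δ) :
    SpineGivenEndpointR12 :=
  spineGivenEndpointR12_of_spine_rec12C (spine_of_rateStubs_coreEdge _ SRec RRec hx h14 h15 h16 h17 h18 h22 hx' h20 h21 h19)

variable (cr : (F : T4Family) → (θ : Stage12Params F 2) → θ.Provisos₁₂ F 2 → (ℕ → ℝ) → List (ULoop F) → SpineCarriers)
  (rr : (F : T4Family) → (θ : Stage12Params F 2) → θ.Provisos₁₂ F 2 → (ℕ → ℝ) → List (ULoop F) → RateCarriers 2)

/-- **THE BC3 COMPOSER: THE ITEM FROM THE CHILDREN'S ESTIMATES KEYED AT THE STAGE-12 TUPLES, ASKED ONLY ON THE GUARDED CLASS** (`N = 2`; XXIVb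
`forall_guarded_of_keyedFaces` at the Stage-12 key with guard `G θ := θ.ZtUnity F 2 ∧ θ.SlotsNondegenerate` — print's partition of unity and non-degenerate present slots, director
LINES №99 (2) ∕ №108): for readings `cr` ∕ `rr` off `(θ, h)` — at every Stage-12 θ with provisos satisfying the guard `θ.ZtUnity F 2 ∧ θ.SlotsNondegenerate` and `θ.Admissible F 2`, every `g₀`, `os`:
N20 `RelWeightBound` and N21 `ShellWeightBound` at `cr F θ h g₀ os` · K4's six rates `RatesAt (datumOfRecord₁₂ F 2 θ h) (rr F θ h g₀ os)` · the same-tuple N19′ ∃δ-edge · the keyed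
extraction clause (positivity + E1∕E2 under (B), END, small tuned couplings) ⇒ `SpineGivenEndpointR12`.  Every hypothesis 0∕1 today; `cr`, `rr` PARAMETERS. [bookkeeping] -/
theorem spineGivenEndpointR12_of_keyedFaces
    (h20 : ∀ (F : T4Family) (θ : Stage12Params F 2) (hP : θ.Provisos₁₂ F 2), (θ.ZtUnity F 2 ∧ θ.SlotsNondegenerate) → θ.Admissible F 2 →
      ∀ (g₀ : ℕ → ℝ) (os : List (ULoop F)),
      RelWeightBound (cr F θ hP g₀ os).l₀ (cr F θ hP g₀ os).T (cr F θ hP g₀ os).A (cr F θ hP g₀ os).B (cr F θ hP g₀ os).Bad (cr F θ hP g₀ os).W)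
    (h21 : ∀ (F : T4Family) (θ : Stage12Params F 2) (hP : θ.Provisos₁₂ F 2), (θ.ZtUnity F 2 ∧ θ.SlotsNondegenerate) → θ.Admissible F 2 →
      ∀ (g₀ : ℕ → ℝ) (os : List (ULoop F)),
      ShellWeightBound (cr F θ hP g₀ os).l₀ (cr F θ hP g₀ os).T (cr F θ hP g₀ os).A (cr F θ hP g₀ os).B (cr F θ hP g₀ os).shA (cr F θ hP g₀ os).shB
        (cr F θ hP g₀ os).Wsh)
    (hrates : ∀ (F : T4Family) (θ : Stage12Params F 2) (hP : θ.Provisos₁₂ F 2), (θ.ZtUnity F 2 ∧ θ.SlotsNondegenerate) → θ.Admissible F 2 →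
      ∀ (g₀ : ℕ → ℝ) (os : List (ULoop F)), RatesAt (datumOfRecord₁₂ F 2 θ hP) (rr F θ hP g₀ os))
    (h19 : ∀ (F : T4Family) (θ : Stage12Params F 2) (hP : θ.Provisos₁₂ F 2), (θ.ZtUnity F 2 ∧ θ.SlotsNondegenerate) → θ.Admissible F 2 →
      ∀ (g₀ : ℕ → ℝ) (os : List (ULoop F)),
      RatesAt (datumOfRecord₁₂ F 2 θ hP) (rr F θ hP g₀ os) → letI := (cr F θ hP g₀ os).dec
        ∃ δ : ℕ → ℝ, NE7.Core (cr F θ hP g₀ os).l₀ (cr F θ hP g₀ os).vol (cr F θ hP g₀ os).T (cr F θ hP g₀ os).Bad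
          (fun K t τ => (cr F θ hP g₀ os).A K t τ - (cr F θ hP g₀ os).shA K t τ) (fun K t τ => (cr F θ hP g₀ os).B K t τ - (cr F θ hP g₀ os).shB K t τ) δ ∧
          Summable δ)
    (hx : ∀ (F : T4Family) (θ : Stage12Params F 2) (hP : θ.Provisos₁₂ F 2), (θ.ZtUnity F 2 ∧ θ.SlotsNondegenerate) → θ.Admissible F 2 →
      B16.EndStatementBPrinted (datumOfRecord₁₂ F 2 θ hP).C → DagBinding.EndpointExistence (datumOfRecord₁₂ F 2 θ hP).C.toB12 →
        ForSmallCouplings (datumOfRecord₁₂ F 2 θ hP) fun g₀ => ∀ os : List (ULoop F),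
          0 < (cr F θ hP g₀ os).l₀ ∧ 0 < (cr F θ hP g₀ os).vol ∧
          (∀ (K : ℕ) (t : ℝ), |t| ≤ (cr F θ hP g₀ os).l₀ →
            T4GenFunBounds.schemeZ ((datumOfRecord₁₂ F 2 θ hP).scheme g₀) os ((cr F θ hP g₀ os).K₀ + K) t =
              ∑ τ ∈ (cr F θ hP g₀ os).T K, (cr F θ hP g₀ os).A K t τ) ∧
          (∀ (K : ℕ) (t : ℝ), |t| ≤ (cr F θ hP g₀ os).l₀ →
            T4GenFunBounds.schemeZ ((datumOfRecord₁₂ F 2 θ hP).scheme g₀) os ((cr F θ hP g₀ os).K₀ + K + 1) t =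
              ∑ τ ∈ (cr F θ hP g₀ os).T K, (cr F θ hP g₀ os).B K t τ)) :
    SpineGivenEndpointR12 :=
  fun F θ hP hG hθ _ _ =>
    forall_guarded_of_keyedFaces (Θ := fun F => Stage12Params F 2) (fun θ => θ.Provisos₁₂ _ 2) (fun θ => θ.Admissible _ 2)
      (fun θ h => datumOfRecord₁₂ _ 2 θ h) (fun θ h => cr _ θ h) (fun θ h => rr _ θ h) (fun θ => θ.ZtUnity _ 2 ∧ θ.SlotsNondegenerate)
      h20 h21 hrates h19 hx F θ hP hG hθ

/-- **THE ITEM FROM THE STUB INSTANCES OF A DIVIDED STAGE-12 CARRIER HOME AND THE PAIR-FORM N19′ EDGE** (`N = 2`; XXV `spine_rec12C_of_rateStubs_twoKeys₁₂`; the stubs are asked at EVERY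
admissible θ — stronger than the unity class needs). [bookkeeping] -/
theorem spineGivenEndpointR12_of_rateStubs_twoKeys₁₂
    (hkeyS : ∀ (F : T4Family) (D : Datum F 2) (g₀ : ℕ → ℝ) (os : List (ULoop F)) (S : SpineCarriers), SRec F D g₀ os S ↔
      ∃ (θ : Stage12Params F 2) (hP : θ.Provisos₁₂ F 2), θ.Admissible F 2 ∧ D = datumOfRecord₁₂ F 2 θ hP ∧ S = cr F θ hP g₀ os)
    (hkeyR : ∀ (F : T4Family) (D : Datum F 2) (g₀ : ℕ → ℝ) (os : List (ULoop F)) (R : RateCarriers 2), RRec F D g₀ os R ↔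
      ∃ (θ : Stage12Params F 2) (hP : θ.Provisos₁₂ F 2), θ.Admissible F 2 ∧ D = datumOfRecord₁₂ F 2 θ hP ∧ R = rr F θ hP g₀ os)
    (hx : S_R00x (fun F D w => IsRecordOfRecord₁₂C F 2 D w) RRec) (h14 : S_N14 RRec) (h15 : S_N15 RRec) (h16 : S_N16 RRec) (h17 : S_N17 RRec)
    (h18 : S_N18 RRec) (h22 : S_N22 RRec) (hx' : S_N27x (fun F D w => IsRecordOfRecord₁₂C F 2 D w) SRec) (h20 : S_N20 SRec) (h21 : S_N21 SRec)
    (h19₂ : ∀ (F : T4Family) (θ : Stage12Params F 2) (hP : θ.Provisos₁₂ F 2) (θ' : Stage12Params F 2) (hP' : θ'.Provisos₁₂ F 2),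
      θ.Admissible F 2 → θ'.Admissible F 2 → datumOfRecord₁₂ F 2 θ' hP' = datumOfRecord₁₂ F 2 θ hP → ∀ (g₀ : ℕ → ℝ) (os : List (ULoop F)),
        RatesAt (datumOfRecord₁₂ F 2 θ hP) (rr F θ' hP' g₀ os) → letI := (cr F θ hP g₀ os).dec
          ∃ δ : ℕ → ℝ, NE7.Core (cr F θ hP g₀ os).l₀ (cr F θ hP g₀ os).vol (cr F θ hP g₀ os).T (cr F θ hP g₀ os).Bad
            (fun K t τ => (cr F θ hP g₀ os).A K t τ - (cr F θ hP g₀ os).shA K t τ) (fun K t τ => (cr F θ hP g₀ os).B K t τ - (cr F θ hP g₀ os).shB K t τ) δ ∧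
            Summable δ) :
    SpineGivenEndpointR12 :=
  spineGivenEndpointR12_of_spine_rec12C
    (spine_rec12C_of_rateStubs_twoKeys₁₂ cr rr SRec RRec hkeyS hkeyR hx h14 h15 h16 h17 h18 h22 hx' h20 h21 h19₂)

end Knits

/-! ## §3 The cluster-level keyed faces: K3′ from K5 «SpineDatum» (and K4's hook) READ AT THE GUARDED STAGE-12 TUPLES — the shape `closes` consumes -/

section KeyedClusters

variable (Inputs : InputsPred 2)

/-- **THE ITEM FROM THE K5 CLUSTER STATEMENT KEYED AT THE GUARDED STAGE-12 TUPLES** (`N = 2`): if at every Stage-12 θ with provisos, `θ.ZtUnity F 2`, `θ.SlotsNondegenerate`,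
`θ.Admissible F 2`, under (B) and END at the datum of record, for all small tuned `g₀` and EVERY loop string the per-string SPINE DATUM `YMDAG.UVSplit.SpineDatum` holds (N20 ∧ N21 ∧ N19-on-cores
∧ budget ∧ `Summable δ` ∧ E1∕E2 at explicit carriers — R420's unguarded K5), then `SpineGivenEndpointR12` — per string by the route module's `stringHybridNE7_of_spineDatum`.  No record
predicate, no world. [bookkeeping] -/
theorem spineGivenEndpointR12_of_keyedSpineDatum
    (h5 : ∀ (F : T4Family) (θ : Stage12Params F 2) (hP : θ.Provisos₁₂ F 2), (θ.ZtUnity F 2 ∧ θ.SlotsNondegenerate) → θ.Admissible F 2 →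
      B16.EndStatementBPrinted (datumOfRecord₁₂ F 2 θ hP).C → DagBinding.EndpointExistence (datumOfRecord₁₂ F 2 θ hP).C.toB12 →
        ForSmallCouplings (datumOfRecord₁₂ F 2 θ hP) fun g₀ => ∀ os : List (ULoop F), SpineDatum (datumOfRecord₁₂ F 2 θ hP) g₀ os) :
    SpineGivenEndpointR12 := by
  intro F θ hP hG hθ _ _
  show (datumOfRecord₁₂ F 2 θ hP).UnderHypotheses _ fun g₀ => T4ApexHybrid.StringwiseHybridNE7 ((datumOfRecord₁₂ F 2 θ hP).scheme g₀)
  intro hB hEnd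
  exact (h5 F θ hP hG hθ hB hEnd).mono fun g₀ hg => stringHybridNE7_of_spineDatum _ g₀ hg

/-- **THE ITEM FROM K4's HOOK AND K5 BOTH KEYED AT THE GUARDED STAGE-12 TUPLES** (`N = 2`; the route glue `B5_at_record`'s mechanism, θ-keyed): K4 «for all small tuned `g₀`, every `os`:
`Inputs`» and K5 «… `Inputs → SpineDatum`» at every guarded θ ⇒ `SpineGivenEndpointR12` (`ForSmallCouplings.and`, modus ponens per string). [bookkeeping] -/
theorem spineGivenEndpointR12_of_keyedSpineRates_spineMatching
    (h4 : ∀ (F : T4Family) (θ : Stage12Params F 2) (hP : θ.Provisos₁₂ F 2), (θ.ZtUnity F 2 ∧ θ.SlotsNondegenerate) → θ.Admissible F 2 →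
      B16.EndStatementBPrinted (datumOfRecord₁₂ F 2 θ hP).C → DagBinding.EndpointExistence (datumOfRecord₁₂ F 2 θ hP).C.toB12 →
        ForSmallCouplings (datumOfRecord₁₂ F 2 θ hP) fun g₀ => ∀ os : List (ULoop F), Inputs F (datumOfRecord₁₂ F 2 θ hP) g₀ os)
    (h5 : ∀ (F : T4Family) (θ : Stage12Params F 2) (hP : θ.Provisos₁₂ F 2), (θ.ZtUnity F 2 ∧ θ.SlotsNondegenerate) → θ.Admissible F 2 →
      B16.EndStatementBPrinted (datumOfRecord₁₂ F 2 θ hP).C → DagBinding.EndpointExistence (datumOfRecord₁₂ F 2 θ hP).C.toB12 →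
        ForSmallCouplings (datumOfRecord₁₂ F 2 θ hP) fun g₀ => ∀ os : List (ULoop F),
          Inputs F (datumOfRecord₁₂ F 2 θ hP) g₀ os → SpineDatum (datumOfRecord₁₂ F 2 θ hP) g₀ os) :
    SpineGivenEndpointR12 := by
  intro F θ hP hG hθ _ _
  show (datumOfRecord₁₂ F 2 θ hP).UnderHypotheses _ fun g₀ => T4ApexHybrid.StringwiseHybridNE7 ((datumOfRecord₁₂ F 2 θ hP).scheme g₀)
  intro hB hEnd
  exact ((h4 F θ hP hG hθ hB hEnd).and (h5 F θ hP hG hθ hB hEnd)).mono fun g₀ hg =>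
    stringHybridNE7_of_spineDatum _ g₀ fun os => hg.2 os (hg.1 os)

end KeyedClusters

/-! ## §4 (v1.1, append-only) The item from the Stage-12 CARRIER HOMES OF RECORD (module XXVII by name) — `S_R00x` discharged at the home -/

section Homes

variable (cr₁₂ : SpineReading₁₂ 2) (𝔯 : RateReading₁₂ 2)

/-- **THE ITEM FROM THE STUB INSTANCES OF THE TWO STAGE-12 CARRIER HOMES OF RECORD AND THE HOME-KEYED N19′ EDGE** (`N = 2`; XXVII `spine_rec12C_of_homes₁₂` ∘ §1): the six K4 stubs at
(T-RATE)₁₂ `RRec₁₂ 𝔯`, the three K5 stubs at (T-SPINE)₁₂ `SRec₁₂ cr₁₂`, and `h19` (for every admissible θ, every datum key `h` of θ's datum, every run length `k`: the rates at the canonical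
bundle `rateCarriersOfRecord₁₂ 𝔯 F h.params h.provisos g₀ os k` give a summable `δ` carrying `Spine.NE7.Core` on the cores of `cr₁₂ F θ hP g₀ os`) ⇒ `SpineGivenEndpointR12` — `S_R00x`
is NOT asked (proved at the home, `s_R00x_rRec₁₂`).  Every remaining stub 0∕1 today; `cr₁₂`, `𝔯` the homes' PARAMETERS. [bookkeeping] -/
theorem spineGivenEndpointR12_of_homes₁₂ (h14 : S_N14 (RRec₁₂ 𝔯)) (h15 : S_N15 (RRec₁₂ 𝔯)) (h16 : S_N16 (RRec₁₂ 𝔯)) (h17 : S_N17 (RRec₁₂ 𝔯))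
    (h18 : S_N18 (RRec₁₂ 𝔯)) (h22 : S_N22 (RRec₁₂ 𝔯)) (hx' : S_N27x (fun F D w => IsRecordOfRecord₁₂C F 2 D w) (SRec₁₂ cr₁₂)) (h20 : S_N20 (SRec₁₂ cr₁₂))
    (h21 : S_N21 (SRec₁₂ cr₁₂))
    (h19 : ∀ (F : T4Family) (θ : Stage12Params F 2) (hP : θ.Provisos₁₂ F 2), θ.Admissible F 2 → ∀ (g₀ : ℕ → ℝ) (os : List (ULoop F))
      (h : Node00.IsDatumOfRecord₁₂C F 2 (datumOfRecord₁₂ F 2 θ hP)) (k : ℕ),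
      RatesAt (datumOfRecord₁₂ F 2 θ hP) (rateCarriersOfRecord₁₂ 𝔯 F h.params h.provisos g₀ os k) → letI := (cr₁₂ F θ hP g₀ os).dec
        ∃ δ : ℕ → ℝ, NE7.Core (cr₁₂ F θ hP g₀ os).l₀ (cr₁₂ F θ hP g₀ os).vol (cr₁₂ F θ hP g₀ os).T (cr₁₂ F θ hP g₀ os).Bad
          (fun K t τ => (cr₁₂ F θ hP g₀ os).A K t τ - (cr₁₂ F θ hP g₀ os).shA K t τ)
          (fun K t τ => (cr₁₂ F θ hP g₀ os).B K t τ - (cr₁₂ F θ hP g₀ os).shB K t τ) δ ∧ Summable δ) :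
    SpineGivenEndpointR12 :=
  spineGivenEndpointR12_of_spine_rec12C (spine_rec12C_of_homes₁₂ cr₁₂ 𝔯 h14 h15 h16 h17 h18 h22 hx' h20 h21 h19)

end Homes

/-! ## §5 (v1.2, append-only) The item from the REGIME-RESTRICTED Stage-12 carrier homes at the rev-15 guard (module XXVIII by name) — the guard
`θ.ZtUnity F 2 ∧ θ.SlotsNondegenerate` REACHES BOTH HOMES AND THE EDGE (dag-ref-H XXVII-PRE-READ-NOTE shape (b)); no canonical parameter, `S_R00x` not asked -/

section HomesOn

variable (cr₁₂ : SpineReading₁₂ 2) (𝔯 : RateReading₁₂ 2)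

/-- **THE ITEM FROM THE STUB INSTANCES OF THE TWO REGIME-RESTRICTED STAGE-12 CARRIER HOMES AT THE ITEM'S OWN GUARD** (`N = 2`; XXVIII `forall_guarded₁₂_of_homes₁₂On` at
`Rg F θ := θ.ZtUnity F 2 ∧ θ.SlotsNondegenerate` ∘ §1 `spineGivenEndpointR12_iff_keyedGuarded`): the six K4 stubs at (T-RATE)₁₂ `RRec₁₂On 𝔯 Rg` and the K5 stubs `S_N20`, `S_N21` at
(T-SPINE)₁₂ `SRec₁₂On cr₁₂ Rg` — each IS its node's estimate asked ONLY of the admissible Stage-12 tuples with provisos satisfying the guard, read AT the tuple (n22-e `s_N1x_rRec₁₂On_iff`,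
n20-d `s_N20_sRec₁₂On_iff`) — the keyed extraction clause `hx` (positivity + E1∕E2 under (B), END, small tuned couplings) and the SAME-TUPLE, ALL-RUN-LENGTHS N19′ edge `h19`, both asked
only under the guard ⇒ `SpineGivenEndpointR12`.  Unlike §4's `_of_homes₁₂` (canonical homes, edge read at `h.params`, stubs at EVERY admissible tuple), here the item's guard is
supplied to EVERY hypothesis and nothing is read at a canonical parameter.  Every hypothesis 0∕1 today; `cr₁₂`, `𝔯` the homes' PARAMETERS. [bookkeeping] -/
theorem spineGivenEndpointR12_of_homes₁₂On
    (h14 : S_N14 (RRec₁₂On 𝔯 fun F θ => θ.ZtUnity F 2 ∧ θ.SlotsNondegenerate)) (h15 : S_N15 (RRec₁₂On 𝔯 fun F θ => θ.ZtUnity F 2 ∧ θ.SlotsNondegenerate))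
    (h16 : S_N16 (RRec₁₂On 𝔯 fun F θ => θ.ZtUnity F 2 ∧ θ.SlotsNondegenerate)) (h17 : S_N17 (RRec₁₂On 𝔯 fun F θ => θ.ZtUnity F 2 ∧ θ.SlotsNondegenerate))
    (h18 : S_N18 (RRec₁₂On 𝔯 fun F θ => θ.ZtUnity F 2 ∧ θ.SlotsNondegenerate)) (h22 : S_N22 (RRec₁₂On 𝔯 fun F θ => θ.ZtUnity F 2 ∧ θ.SlotsNondegenerate))
    (h20 : S_N20 (SRec₁₂On cr₁₂ fun F θ => θ.ZtUnity F 2 ∧ θ.SlotsNondegenerate)) (h21 : S_N21 (SRec₁₂On cr₁₂ fun F θ => θ.ZtUnity F 2 ∧ θ.SlotsNondegenerate))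
    (hx : ∀ (F : T4Family) (θ : Stage12Params F 2) (hP : θ.Provisos₁₂ F 2), (θ.ZtUnity F 2 ∧ θ.SlotsNondegenerate) → θ.Admissible F 2 →
      B16.EndStatementBPrinted (datumOfRecord₁₂ F 2 θ hP).C → DagBinding.EndpointExistence (datumOfRecord₁₂ F 2 θ hP).C.toB12 →
        ForSmallCouplings (datumOfRecord₁₂ F 2 θ hP) fun g₀ => ∀ os : List (ULoop F),
          0 < (cr₁₂ F θ hP g₀ os).l₀ ∧ 0 < (cr₁₂ F θ hP g₀ os).vol ∧
          (∀ (K : ℕ) (t : ℝ), |t| ≤ (cr₁₂ F θ hP g₀ os).l₀ →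
            T4GenFunBounds.schemeZ ((datumOfRecord₁₂ F 2 θ hP).scheme g₀) os ((cr₁₂ F θ hP g₀ os).K₀ + K) t =
              ∑ τ ∈ (cr₁₂ F θ hP g₀ os).T K, (cr₁₂ F θ hP g₀ os).A K t τ) ∧
          (∀ (K : ℕ) (t : ℝ), |t| ≤ (cr₁₂ F θ hP g₀ os).l₀ →
            T4GenFunBounds.schemeZ ((datumOfRecord₁₂ F 2 θ hP).scheme g₀) os ((cr₁₂ F θ hP g₀ os).K₀ + K + 1) t =
              ∑ τ ∈ (cr₁₂ F θ hP g₀ os).T K, (cr₁₂ F θ hP g₀ os).B K t τ))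
    (h19 : ∀ (F : T4Family) (θ : Stage12Params F 2) (hP : θ.Provisos₁₂ F 2), (θ.ZtUnity F 2 ∧ θ.SlotsNondegenerate) → θ.Admissible F 2 →
      ∀ (g₀ : ℕ → ℝ) (os : List (ULoop F)), (∀ k : ℕ, RatesAt (datumOfRecord₁₂ F 2 θ hP) (rateCarriersOfRecord₁₂ 𝔯 F θ hP g₀ os k)) → letI := (cr₁₂ F θ hP g₀ os).dec
        ∃ δ : ℕ → ℝ, NE7.Core (cr₁₂ F θ hP g₀ os).l₀ (cr₁₂ F θ hP g₀ os).vol (cr₁₂ F θ hP g₀ os).T (cr₁₂ F θ hP g₀ os).Bad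
          (fun K t τ => (cr₁₂ F θ hP g₀ os).A K t τ - (cr₁₂ F θ hP g₀ os).shA K t τ)
          (fun K t τ => (cr₁₂ F θ hP g₀ os).B K t τ - (cr₁₂ F θ hP g₀ os).shB K t τ) δ ∧ Summable δ) :
    SpineGivenEndpointR12 :=
  spineGivenEndpointR12_iff_keyedGuarded.mpr
    (forall_guarded₁₂_of_homes₁₂On cr₁₂ 𝔯 (fun F θ => θ.ZtUnity F 2 ∧ θ.SlotsNondegenerate) h14 h15 h16 h17 h18 h22 h20 h21 hx h19)

/-- **THE SAME WITH EVERY HYPOTHESIS IN ITS GUARDED θ-FORM** (`N = 2`; XXVIII `forall_guarded₁₂_of_homes₁₂On_faces`): at every Stage-12 θ with provisos satisfying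
`θ.ZtUnity F 2 ∧ θ.SlotsNondegenerate` and `θ.Admissible F 2`, every `g₀`, `os` — K4's six rates at EVERY run length `k` of the rate reading `rateCarriersOfRecord₁₂ 𝔯 F θ hP g₀ os k` on
the datum of record · N20 `RelWeightBound` and N21 `ShellWeightBound` at the spine reading `cr₁₂ F θ hP g₀ os` · the keyed extraction clause · the same-tuple all-run-lengths N19′ edge ⇒
`SpineGivenEndpointR12`.  The BC3-composer shape of §2's `spineGivenEndpointR12_of_keyedFaces` with the rate reading THE HOME's (run-length-indexed) and the edge fed the rates at all
run lengths. [bookkeeping] -/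
theorem spineGivenEndpointR12_of_homes₁₂On_faces
    (hrates : ∀ (F : T4Family) (θ : Stage12Params F 2) (hP : θ.Provisos₁₂ F 2), (θ.ZtUnity F 2 ∧ θ.SlotsNondegenerate) → θ.Admissible F 2 →
      ∀ (g₀ : ℕ → ℝ) (os : List (ULoop F)) (k : ℕ), RatesAt (datumOfRecord₁₂ F 2 θ hP) (rateCarriersOfRecord₁₂ 𝔯 F θ hP g₀ os k))
    (h20 : ∀ (F : T4Family) (θ : Stage12Params F 2) (hP : θ.Provisos₁₂ F 2), (θ.ZtUnity F 2 ∧ θ.SlotsNondegenerate) → θ.Admissible F 2 →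
      ∀ (g₀ : ℕ → ℝ) (os : List (ULoop F)),
      RelWeightBound (cr₁₂ F θ hP g₀ os).l₀ (cr₁₂ F θ hP g₀ os).T (cr₁₂ F θ hP g₀ os).A (cr₁₂ F θ hP g₀ os).B (cr₁₂ F θ hP g₀ os).Bad (cr₁₂ F θ hP g₀ os).W)
    (h21 : ∀ (F : T4Family) (θ : Stage12Params F 2) (hP : θ.Provisos₁₂ F 2), (θ.ZtUnity F 2 ∧ θ.SlotsNondegenerate) → θ.Admissible F 2 →
      ∀ (g₀ : ℕ → ℝ) (os : List (ULoop F)),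
      ShellWeightBound (cr₁₂ F θ hP g₀ os).l₀ (cr₁₂ F θ hP g₀ os).T (cr₁₂ F θ hP g₀ os).A (cr₁₂ F θ hP g₀ os).B (cr₁₂ F θ hP g₀ os).shA (cr₁₂ F θ hP g₀ os).shB
        (cr₁₂ F θ hP g₀ os).Wsh)
    (hx : ∀ (F : T4Family) (θ : Stage12Params F 2) (hP : θ.Provisos₁₂ F 2), (θ.ZtUnity F 2 ∧ θ.SlotsNondegenerate) → θ.Admissible F 2 →
      B16.EndStatementBPrinted (datumOfRecord₁₂ F 2 θ hP).C → DagBinding.EndpointExistence (datumOfRecord₁₂ F 2 θ hP).C.toB12 →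
        ForSmallCouplings (datumOfRecord₁₂ F 2 θ hP) fun g₀ => ∀ os : List (ULoop F),
          0 < (cr₁₂ F θ hP g₀ os).l₀ ∧ 0 < (cr₁₂ F θ hP g₀ os).vol ∧
          (∀ (K : ℕ) (t : ℝ), |t| ≤ (cr₁₂ F θ hP g₀ os).l₀ →
            T4GenFunBounds.schemeZ ((datumOfRecord₁₂ F 2 θ hP).scheme g₀) os ((cr₁₂ F θ hP g₀ os).K₀ + K) t =
              ∑ τ ∈ (cr₁₂ F θ hP g₀ os).T K, (cr₁₂ F θ hP g₀ os).A K t τ) ∧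
          (∀ (K : ℕ) (t : ℝ), |t| ≤ (cr₁₂ F θ hP g₀ os).l₀ →
            T4GenFunBounds.schemeZ ((datumOfRecord₁₂ F 2 θ hP).scheme g₀) os ((cr₁₂ F θ hP g₀ os).K₀ + K + 1) t =
              ∑ τ ∈ (cr₁₂ F θ hP g₀ os).T K, (cr₁₂ F θ hP g₀ os).B K t τ))
    (h19 : ∀ (F : T4Family) (θ : Stage12Params F 2) (hP : θ.Provisos₁₂ F 2), (θ.ZtUnity F 2 ∧ θ.SlotsNondegenerate) → θ.Admissible F 2 →
      ∀ (g₀ : ℕ → ℝ) (os : List (ULoop F)), (∀ k : ℕ, RatesAt (datumOfRecord₁₂ F 2 θ hP) (rateCarriersOfRecord₁₂ 𝔯 F θ hP g₀ os k)) → letI := (cr₁₂ F θ hP g₀ os).dec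
        ∃ δ : ℕ → ℝ, NE7.Core (cr₁₂ F θ hP g₀ os).l₀ (cr₁₂ F θ hP g₀ os).vol (cr₁₂ F θ hP g₀ os).T (cr₁₂ F θ hP g₀ os).Bad
          (fun K t τ => (cr₁₂ F θ hP g₀ os).A K t τ - (cr₁₂ F θ hP g₀ os).shA K t τ)
          (fun K t τ => (cr₁₂ F θ hP g₀ os).B K t τ - (cr₁₂ F θ hP g₀ os).shB K t τ) δ ∧ Summable δ) :
    SpineGivenEndpointR12 :=
  spineGivenEndpointR12_iff_keyedGuarded.mpr
    (forall_guarded₁₂_of_homes₁₂On_faces cr₁₂ 𝔯 (fun F θ => θ.ZtUnity F 2 ∧ θ.SlotsNondegenerate) hrates h20 h21 hx h19)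

end HomesOn

/-! ## §6 (v1.3, append-only) THE ITEM IS «B5 AT node00-def-RR-2's CN RECORD CLASS» (`Node00.IsRecordOfRecord₁₂CN F 2` = the Stage-12 records whose parameter carries
print's partition of unity AND non-degenerate present slots, `Node00/Record12DatumKeyCN`; module XXVIII §5) -/

section RegimeRecord

/-- **THE ITEM ⟺ B5 `Spine` AT THE CN RECORD CLASS OF RECORD** (`N = 2`): `SpineGivenEndpointR12` holds iff `T4ApexHybrid.HybridNE7Under D END` at EVERY Stage-12 record `(D, w)`
realised by an admissible tuple with provisos satisfying `θ.ZtUnity F 2 ∧ θ.SlotsNondegenerate` (§1 `spineGivenEndpointR12_iff_keyedGuarded` ∘ XXVIII `spine_rec12CN_iff_forall_guarded`,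
i.e. RR-2's junction `forall_isRecordOfRecord₁₂CN_iff`).  So every record-level road of this package (XII∕XIV∕XXIV∕XXVII∕XXVIII) run at `Rec := IsRecordOfRecord₁₂CN F 2` concludes the
item EXACTLY — neither the stronger `Spine ₁₂C` nor a weakening. [bookkeeping] -/
theorem spineGivenEndpointR12_iff_spine_rec12CN :
    SpineGivenEndpointR12 ↔ Spine (N := 2) fun F D w => Node00.IsRecordOfRecord₁₂CN F 2 D w :=
  spineGivenEndpointR12_iff_keyedGuarded.trans (spine_rec12CN_iff_forall_guarded (N := 2)).symm

/-- **THE ITEM FROM B5 AT THE RECORD CLASS OF ANY REGIME CONTAINING THE GUARD** (`N = 2`; XXVIII `spine_rec12COn_anti`): e.g. the trivial regime (`Spine ₁₂C`, §1), the unity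
regime `θ.ZtUnity F 2` alone, or the guard itself. [bookkeeping] -/
theorem spineGivenEndpointR12_of_spine_rec12COn {Rg : (F : T4Family) → Stage12Params F 2 → Prop}
    (hle : ∀ (F : T4Family) (θ : Stage12Params F 2), θ.ZtUnity F 2 ∧ θ.SlotsNondegenerate → Rg F θ)
    (h : Spine (N := 2) fun F D w => Node00.IsRecordOfRecord₁₂COn F 2 Rg D w) : SpineGivenEndpointR12 :=
  spineGivenEndpointR12_iff_spine_rec12CN.mpr (spine_rec12COn_anti (Rg := Node00.unityNondeg₁₂ 2) hle h)

/-- **THE ITEM FROM THE STUBS AT THE GUARD-RESTRICTED HOMES, THROUGH THE CN RECORD CLASS** (`N = 2`; XXVIII `spine_rec12CN_of_homes₁₂On` ∘ `spineGivenEndpointR12_iff_spine_rec12CN`):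
§5's `spineGivenEndpointR12_of_homes₁₂On` with the regime spelled `Node00.unityNondeg₁₂ 2` (RR-2's name for the guard of record) — the same term up to the abbreviation.
[bookkeeping] -/
theorem spineGivenEndpointR12_of_homes₁₂CN (cr₁₂ : SpineReading₁₂ 2) (𝔯 : RateReading₁₂ 2)
    (h14 : S_N14 (RRec₁₂On 𝔯 (Node00.unityNondeg₁₂ 2))) (h15 : S_N15 (RRec₁₂On 𝔯 (Node00.unityNondeg₁₂ 2))) (h16 : S_N16 (RRec₁₂On 𝔯 (Node00.unityNondeg₁₂ 2)))
    (h17 : S_N17 (RRec₁₂On 𝔯 (Node00.unityNondeg₁₂ 2))) (h18 : S_N18 (RRec₁₂On 𝔯 (Node00.unityNondeg₁₂ 2))) (h22 : S_N22 (RRec₁₂On 𝔯 (Node00.unityNondeg₁₂ 2)))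
    (h20 : S_N20 (SRec₁₂On cr₁₂ (Node00.unityNondeg₁₂ 2))) (h21 : S_N21 (SRec₁₂On cr₁₂ (Node00.unityNondeg₁₂ 2)))
    (hx : ∀ (F : T4Family) (θ : Stage12Params F 2) (hP : θ.Provisos₁₂ F 2), (θ.ZtUnity F 2 ∧ θ.SlotsNondegenerate) → θ.Admissible F 2 →
      B16.EndStatementBPrinted (datumOfRecord₁₂ F 2 θ hP).C → DagBinding.EndpointExistence (datumOfRecord₁₂ F 2 θ hP).C.toB12 →
        ForSmallCouplings (datumOfRecord₁₂ F 2 θ hP) fun g₀ => ∀ os : List (ULoop F),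
          0 < (cr₁₂ F θ hP g₀ os).l₀ ∧ 0 < (cr₁₂ F θ hP g₀ os).vol ∧
          (∀ (K : ℕ) (t : ℝ), |t| ≤ (cr₁₂ F θ hP g₀ os).l₀ →
            T4GenFunBounds.schemeZ ((datumOfRecord₁₂ F 2 θ hP).scheme g₀) os ((cr₁₂ F θ hP g₀ os).K₀ + K) t =
              ∑ τ ∈ (cr₁₂ F θ hP g₀ os).T K, (cr₁₂ F θ hP g₀ os).A K t τ) ∧
          (∀ (K : ℕ) (t : ℝ), |t| ≤ (cr₁₂ F θ hP g₀ os).l₀ →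
            T4GenFunBounds.schemeZ ((datumOfRecord₁₂ F 2 θ hP).scheme g₀) os ((cr₁₂ F θ hP g₀ os).K₀ + K + 1) t =
              ∑ τ ∈ (cr₁₂ F θ hP g₀ os).T K, (cr₁₂ F θ hP g₀ os).B K t τ))
    (h19 : ∀ (F : T4Family) (θ : Stage12Params F 2) (hP : θ.Provisos₁₂ F 2), (θ.ZtUnity F 2 ∧ θ.SlotsNondegenerate) → θ.Admissible F 2 →
      ∀ (g₀ : ℕ → ℝ) (os : List (ULoop F)), (∀ k : ℕ, RatesAt (datumOfRecord₁₂ F 2 θ hP) (rateCarriersOfRecord₁₂ 𝔯 F θ hP g₀ os k)) → letI := (cr₁₂ F θ hP g₀ os).dec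
        ∃ δ : ℕ → ℝ, NE7.Core (cr₁₂ F θ hP g₀ os).l₀ (cr₁₂ F θ hP g₀ os).vol (cr₁₂ F θ hP g₀ os).T (cr₁₂ F θ hP g₀ os).Bad
          (fun K t τ => (cr₁₂ F θ hP g₀ os).A K t τ - (cr₁₂ F θ hP g₀ os).shA K t τ)
          (fun K t τ => (cr₁₂ F θ hP g₀ os).B K t τ - (cr₁₂ F θ hP g₀ os).shB K t τ) δ ∧ Summable δ) :
    SpineGivenEndpointR12 :=
  spineGivenEndpointR12_iff_spine_rec12CN.mpr (spine_rec12CN_of_homes₁₂On cr₁₂ 𝔯 h14 h15 h16 h17 h18 h22 h20 h21 hx h19)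

end RegimeRecord

/-! ## §7 (v1.4, append-only) THE ITEM AT THE CHILDREN's RATE READING OF RECORD, EDITION 1 `YMDAG.UVSplit.readingOfRecord₁₂ w1 ℓ₃ ne2 ne1` (dag-n22-e; module XXIX
`…N27AtReadingOfRecord12` by name): the guard-restricted knit with every rate slot a sentence about NAMED objects, N17 eliminated -/

section ReadingOfRecord

open Node00 (IsDatumOfRecord₁₂C NE3Letters₁₁ NE2Objects₁₁ ne3ConstLayerOfRecord₁₁)
open Summit.QuantumFields.YangMills.BalabanUVNodes.N16Regime (InEndRegime)
open Summit.QuantumFields.YangMills.BalabanUVNodes.N16LeafSlot (LeafSlot)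

variable (cr₁₂ : SpineReading₁₂ 2)
  (w1 : (F : T4Family) → (θ : Stage12Params F 2) → Node00.W1.ReadingData F (Node00.MatA 2) θ.τ9.M) (ℓ₃ : T4Family → NE3Letters₁₁)
  (ne2 : (F : T4Family) → Stage12Params F 2 → (ℕ → ℝ) → List (ULoop F) → ℕ → NE2Objects₁₁)
  (ne1 : (F : T4Family) → Stage12Params F 2 → (ℕ → ℝ) → List (ULoop F) → NE1pCarriers)

/-- **K3′ FROM THE RATE SENTENCES AT THE GUARD-RESTRICTED HOME OF THE READING OF RECORD** (`N = 2`; §6 `spineGivenEndpointR12_of_spine_rec12COn` at the guard itself ∘ XXIX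
`spine_rec12COn_at_readingOfRecord₁₂_of_leafSlot`): for every family and every Stage-12 tuple with provisos satisfying `θ.ZtUnity F 2 ∧ θ.SlotsNondegenerate`, admissible — NE1′ on the
residual dressed tower `ne1 F θ g₀ os` · NE2 on the residual layers `ne2 F θ g₀ os k` · NE5 ∕ NE9 on node00-def-W1's objects `(w1 F θ).u3Objects θ.γ` and the (D4) β-read-out on the datum there,
per run length (`g₀`, `os` idle) · `InEndRegime ∧ LeafSlot` at node00-def-RR-1's constant layer once per guarded family (dag-n16-e) · N17 ELIMINATED (dag-n17-a `s_N17_of_D4_N18`) · N20 ∕ N21 at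
`SRec₁₂On cr₁₂ (guard)`, the guarded keyed extraction clause and the same-tuple N19′ edge ⇒ `SpineGivenEndpointR12`.  The guard reaches EVERY hypothesis; producer faces for the slots
BY NAME are dag-n14-c ∕ n15-d ∕ n16-e ∕ n18-d ∕ n22-c ∕ n22-e ∕ n20-c∕d ∕ n21-c∕d∕e ∕ n19-d's (XXIX's field-by-field table), each conditional on its node's DISPLAYED estimate.  Every
hypothesis 0∕1 today; the canonical-home twin is `spineGivenEndpointR12_of_spine_rec12C (spine_rec12C_at_readingOfRecord₁₂_of_leafSlot …)`. [bookkeeping] -/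
theorem spineGivenEndpointR12_at_readingOfRecord₁₂On
    (h14 : ∀ (F : T4Family) (θ : Stage12Params F 2), θ.Provisos₁₂ F 2 → (θ.ZtUnity F 2 ∧ θ.SlotsNondegenerate) → θ.Admissible F 2 →
      ∀ (g₀ : ℕ → ℝ) (os : List (ULoop F)), N14At (ne1 F θ g₀ os))
    (h15 : ∀ (F : T4Family) (θ : Stage12Params F 2), θ.Provisos₁₂ F 2 → (θ.ZtUnity F 2 ∧ θ.SlotsNondegenerate) → θ.Admissible F 2 →
      ∀ (g₀ : ℕ → ℝ) (os : List (ULoop F)) (k : ℕ), N15At (ne2OfRecord₁₁ (ne2 F θ g₀ os k)))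
    (h16 : ∀ (F : T4Family), (∃ θ : Stage12Params F 2, θ.Provisos₁₂ F 2 ∧ (θ.ZtUnity F 2 ∧ θ.SlotsNondegenerate) ∧ θ.Admissible F 2) →
      InEndRegime (ne3OfRecord₁₁ F (ne3ConstLayerOfRecord₁₁ F 2 (ℓ₃ F))) ∧ LeafSlot (ne3OfRecord₁₁ F (ne3ConstLayerOfRecord₁₁ F 2 (ℓ₃ F))))
    (h18 : ∀ (F : T4Family) (θ : Stage12Params F 2), θ.Provisos₁₂ F 2 → (θ.ZtUnity F 2 ∧ θ.SlotsNondegenerate) → θ.Admissible F 2 → ∀ k : ℕ,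
      N18At (u3OfRecord₁₂ θ ((w1 F θ).u3Objects θ.γ) k))
    (h22 : ∀ (F : T4Family) (θ : Stage12Params F 2), θ.Provisos₁₂ F 2 → (θ.ZtUnity F 2 ∧ θ.SlotsNondegenerate) → θ.Admissible F 2 → ∀ k : ℕ,
      N22At (u3OfRecord₁₂ θ ((w1 F θ).u3Objects θ.γ) k))
    (hD4 : ∀ (F : T4Family) (θ : Stage12Params F 2) (hP : θ.Provisos₁₂ F 2), (θ.ZtUnity F 2 ∧ θ.SlotsNondegenerate) → θ.Admissible F 2 → ∀ k : ℕ,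
      ReadOutAt (datumOfRecord₁₂ F 2 θ hP) (u3OfRecord₁₂ θ ((w1 F θ).u3Objects θ.γ) k))
    (h20 : S_N20 (SRec₁₂On cr₁₂ fun F θ => θ.ZtUnity F 2 ∧ θ.SlotsNondegenerate))
    (h21 : S_N21 (SRec₁₂On cr₁₂ fun F θ => θ.ZtUnity F 2 ∧ θ.SlotsNondegenerate))
    (hx : ∀ (F : T4Family) (θ : Stage12Params F 2) (hP : θ.Provisos₁₂ F 2), (θ.ZtUnity F 2 ∧ θ.SlotsNondegenerate) → θ.Admissible F 2 →
      B16.EndStatementBPrinted (datumOfRecord₁₂ F 2 θ hP).C → DagBinding.EndpointExistence (datumOfRecord₁₂ F 2 θ hP).C.toB12 →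
        ForSmallCouplings (datumOfRecord₁₂ F 2 θ hP) fun g₀ => ∀ os : List (ULoop F),
          0 < (cr₁₂ F θ hP g₀ os).l₀ ∧ 0 < (cr₁₂ F θ hP g₀ os).vol ∧
          (∀ (K : ℕ) (t : ℝ), |t| ≤ (cr₁₂ F θ hP g₀ os).l₀ →
            T4GenFunBounds.schemeZ ((datumOfRecord₁₂ F 2 θ hP).scheme g₀) os ((cr₁₂ F θ hP g₀ os).K₀ + K) t =
              ∑ τ ∈ (cr₁₂ F θ hP g₀ os).T K, (cr₁₂ F θ hP g₀ os).A K t τ) ∧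
          (∀ (K : ℕ) (t : ℝ), |t| ≤ (cr₁₂ F θ hP g₀ os).l₀ →
            T4GenFunBounds.schemeZ ((datumOfRecord₁₂ F 2 θ hP).scheme g₀) os ((cr₁₂ F θ hP g₀ os).K₀ + K + 1) t =
              ∑ τ ∈ (cr₁₂ F θ hP g₀ os).T K, (cr₁₂ F θ hP g₀ os).B K t τ))
    (h19 : ∀ (F : T4Family) (θ : Stage12Params F 2) (hP : θ.Provisos₁₂ F 2), (θ.ZtUnity F 2 ∧ θ.SlotsNondegenerate) → θ.Admissible F 2 →
      ∀ (g₀ : ℕ → ℝ) (os : List (ULoop F)),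
      (∀ k : ℕ, RatesAt (datumOfRecord₁₂ F 2 θ hP) (rateCarriersOfRecord₁₂ (readingOfRecord₁₂ w1 ℓ₃ ne2 ne1) F θ hP g₀ os k)) → letI := (cr₁₂ F θ hP g₀ os).dec
        ∃ δ : ℕ → ℝ, NE7.Core (cr₁₂ F θ hP g₀ os).l₀ (cr₁₂ F θ hP g₀ os).vol (cr₁₂ F θ hP g₀ os).T (cr₁₂ F θ hP g₀ os).Bad
          (fun K t τ => (cr₁₂ F θ hP g₀ os).A K t τ - (cr₁₂ F θ hP g₀ os).shA K t τ)
          (fun K t τ => (cr₁₂ F θ hP g₀ os).B K t τ - (cr₁₂ F θ hP g₀ os).shB K t τ) δ ∧ Summable δ) :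
    SpineGivenEndpointR12 :=
  spineGivenEndpointR12_of_spine_rec12COn (Rg := fun F θ => θ.ZtUnity F 2 ∧ θ.SlotsNondegenerate) (fun _ _ h => h)
    (spine_rec12COn_at_readingOfRecord₁₂_of_leafSlot cr₁₂ w1 ℓ₃ ne2 ne1 (fun F θ => θ.ZtUnity F 2 ∧ θ.SlotsNondegenerate)
      h14 h15 h16 h18 h22 hD4 h20 h21 hx h19)

end ReadingOfRecord

end Summit.QuantumFields.YangMills.Theorems.BalabanUVNodesN27SpineRecord
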